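import Summits.QuantumFields.BalabanUV.T4Continuum.Support.NE7EffectiveFormLowerBoundSocketUniform
import Summits.QuantumFields.BalabanUV.T4Continuum.Support.NE7EffectiveFormLowerBoundClass
import HarnessLib

/-!
# NE7EffectiveFormLowerBoundUniform — (G′) AT d = 4 WITH A LEVEL-UNIFORM DATUM RADIUS: `∃ ε₀ ∀ ε ∀ N ∃ δV ∀ j ∀ V₀ ∀ U♯ …` (lineage `b2b-balaban-t4-ne7-p1`, gen 119, file U4a of the uniform
# (G′) chain: H15 and H16 re-issued on U3)

Cell `pub-balaban`, rung (B)+1 sub-cell t4, CRUX PROVER NE7 #1 (OWNER of row NE7), generation 119.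
WHY.  ✓ H15∕H16 are (G′) with `∀ N ∀ j ∃ δV` (the admissible datum radius may shrink with the level).  With ✓ U3 `NE7EffectiveFormLowerBoundSocketUniform` (socket on U1 + row NE7b's uniform
multiplier identity) and the already-uniform letter ✓ H15 `stripped_multiplier_letter_allData`, the same proofs give `∀ N ∃ δV ∀ j`: constants AND datum radius level-uniform.
WHAT ([folklore]; 0 def, 0 sorry; d = 4): **`effectiveForm_lower_bound_uniform`**, **`effectiveForm_lower_bound_class_uniform`** (SlicePoincare discharged on the class by row NE3's
`classSlicePoincare_of_lines'`).
HONEST FRAMING (page 1): (G′) is row NE7's binder target about OUR lattice objects in the all-data frame; NOT Bałaban's NE7 as printed, NOT a spine node by itself (spine 0∕9 until the NE7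
record consumes it); nothing of Bałaban's asserted; finite T⁴ rung (B)+1 — NOT continuum YM on ℝ⁴, NOT infinite volume, NOT mass gap, NOT BetaPertH, NOT Clay.
-/

set_option autoImplicit false

open scoped BigOperators Matrix Matrix.Norms.L2Operator Topology
open NormedSpace Finset Set Filter Metric

namespace Summit.QuantumFields.BalabanUV.T4Continuum.NE7EffectiveFormLowerBoundUniform

open Literature.MathematicalPhysics.QuantumFieldTheory.Balaban1983to89
open B7Prop1Explicit B7Prop2Explicit MatrixLog UnitaryModel
open T4AveragingDeficitWall (IsUnitaryCfg IsSkewDir SmallField Ad curl curlAt curlSq dirSq dirL1 fineAction)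
open T4AveragingDeficitWallBoundary (IsPeriodicCfg periodBox)
open AveragingDeficitTorusChart (TDir chart chartDir resDir extDir)
open AveragingDeficitTwoLevelPrep (twoLevelSmall skewSub skewPR)
open AveragingDeficitMultiLevelPrep (cavgIter tower levelQ levelQ' LevelSmall tower_ne_zero)
open AveragingDeficitMultiLevelBridge (tower_eq cavgIter_eq_avgIter)
open MatrixNorms (nhsNormSq)
open MinimalActionLevels (perWin stepWt)
open MinimalActionSandwich (IsMinimiser minAct)
open MinimalActionRate (sfClass)
open NE7RadIterUniform (radD radD_nonneg radIter_le_two_mul)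
open NE7StraightTowerCurlEnergy (eC mC)
open NE3QbarIterCovLiftPrep (cruxC)
open NE3RightInverseSolveLetters (thetaLoc)
open NE3SlicePoincareShape (SlicePoincare)
open NE3FrameFreeSliceW (frameFreeBlockLandauW)
open NE7SliceRepHessianFloor (liftMassC liftCurlC)
open NE3TangentCovariantTower (framePotW)
open NE3HatInvCurlLetters (curl1C curl1C_nonneg)
open ReplicationRightInverseBound (radSum radSum_le)
open AveragingDeficitMultiLevelPrep (radIter)
open BlockAverageVaryHolo (nbRad)
open NE3CovariantLineSumsError (Csup Csup_nonneg)
open ShellMeasureAverageProp4General (C1cov C1cov_pos)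
open NE3.SupplierB8SfClassPrep (pdev_le_of_smallField)
open NE7MinimalOrbitDatumContinuity (thresholds)
open NE7StrippedConstraintMap (strippedConstraint)
open NE7EffectiveFormLowerBoundSocketUniform (effectiveForm_lower_bound_of_localLetter_uniform)
open NE7EffectiveFormLowerBound (stripped_multiplier_letter_allData)
open NE3SlicePoincareBudgetLine (ShLine SmallYLine CPLine)
open NE3ClassRadiusFamily (classSlicePoincare_of_lines' CPLine_nonneg)
open NE3CovariantLineSumsL2 (C2sq)
open NE3CovariantLineSumsL2Tower (rho)
open NE7EffectiveFormCoarseCurlAllLevels (stepWt_four)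

noncomputable section

variable {n : Type} [Fintype n] [DecidableEq n]

/-- **(G′), d = 4, j- AND N-UNIFORM INCLUDING THE DATUM RADIUS** (`∀ N ∃ δV ∀ j`; see the module docstring; constants explicit; `C_Λ(ε) = 2·curl1C·ε·(128·C₁L²·4(4L+1)⁴·L²)`). [folklore] -/
theorem effectiveForm_lower_bound_uniform [Nonempty n] {L : ℕ} [NeZero L] (hL : 2 ≤ L) :
    ∃ ε₀ : ℝ, 0 < ε₀ ∧ ∀ ε : ℝ, 0 < ε → ε ≤ ε₀ →
      4 * (2 * ε) * radD 4 L * (((L : ℝ) ^ 2)⁻¹) ^ 2 ≤ 1 → twoLevelSmall 4 L * (2 * (2 * ε) * ((L : ℝ) ^ 2)⁻¹) ≤ 1 →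
      8 * (L : ℝ) * mC 4 L (Fintype.card n) * ε * ((L : ℝ) ^ 2)⁻¹ ≤ 1 → ε ≤ 1 → cruxC 4 L * ε < 1 → thetaLoc 4 L * ε ≤ 1 / 2 → 43584 * ε ≤ 1 / 2 →
      C0 4 * (2 * (3 * ε)) ≤ 1 / 3 → 4 * (2 * (3 * ε)) ≤ c2' 4 L →
      Real.exp (4 * (800 * (((4 : ℕ) : ℝ) + 1) ^ 2 * (((4 : ℕ) : ℝ) + 4)) * (3 * ε)) ≤ 3 / 2 →
      4 * ε * radD 4 L * (((L : ℝ) ^ 2)⁻¹) ^ 2 ≤ 1 →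
      (16 * ((4 : ℝ) + 1) * ((4 : ℝ) + 4) * (L : ℝ) ^ 2 * Csup 4 L * (4 * (2 * (nbRad 4 L : ℝ) + 1) ^ 4)) * (8 / 3 * ε * ((L : ℝ) ^ 2)⁻¹) ≤ ((L : ℝ) / (L : ℝ) ^ 4) / 2 →
      ∀ (N : ℕ) [NeZero N], 1 ≤ N →
      ∃ δV : ℝ, 0 < δV ∧ ∀ j : ℕ,
        ∀ V₀ ∈ {V : Site 4 → Fin 4 → (Matrix n n ℂ)ˣ | IsUnitaryCfg V ∧ IsPeriodicCfg V (N : ℤ) ∧ SmallField V δV},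
        ∀ Us : Site 4 → Fin 4 → (Matrix n n ℂ)ˣ, IsMinimiser 4 (sfClass 4 L N ε) L N (j + 1) V₀ Us →
        ∀ CP : ℝ, 0 ≤ CP → SlicePoincare L (j + 1) Us (frameFreeBlockLandauW (d := 4) (n := n) L N (j + 1) Us) CP (periodBox (N * L ^ (j + 1))) →
        28 * (Fintype.card (T4AveragingDeficitWall.Plane 4) : ℝ) * ε * (4 * CP * Fintype.card n) ≤ 1 → ∀ θ : ℝ, 0 < θ →
        (2 * curl1C 4 L * ε * (128 * (C1cov 4 * (L : ℝ) ^ 2 * (4 * (4 * (L : ℝ) + 1) ^ 4)) * (L : ℝ) ^ 2)) * (2 * (4 * CP * Fintype.card n)) ≤ 1 →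
        ∀ v : ↥(skewSub 4 n N),
          (1 - (2 * curl1C 4 L * ε * (128 * (C1cov 4 * (L : ℝ) ^ 2 * (4 * (4 * (L : ℝ) + 1) ^ 4)) * (L : ℝ) ^ 2)) * (2 * (4 * CP * Fintype.card n)))
              * (((stepWt 4 L)⁻¹) ^ (j + 1) * ∑ P ∈ perWin 4 N, nhsNormSq (curl V₀ (chartDir (ContinuousLinearMap.id ℝ (Matrix n n ℂ)) N (v : TDir 4 n N)) P))
            ≤ ((1 + θ) + 2 * ((1 + θ) * (14 * (Fintype.card (T4AveragingDeficitWall.Plane 4) : ℝ) * ε) + (1 + θ⁻¹) * (36 * eC 4 L (Fintype.card n) ^ 2 * ε ^ 2))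
                    * (4 * CP * Fintype.card n))
                * fderiv ℝ (fderiv ℝ (fun y : ↥(skewSub 4 n N) => minAct 4 (sfClass 4 L N ε) L N (j + 1) (chart (ContinuousLinearMap.id ℝ (Matrix n n ℂ)) N V₀ (y : TDir 4 n N)))) 0 v v
              + ((stepWt 4 L)⁻¹) ^ (j + 1)
                * (2 * (((1 + θ) + 2 * ((1 + θ) * (14 * (Fintype.card (T4AveragingDeficitWall.Plane 4) : ℝ) * ε) + (1 + θ⁻¹) * (36 * eC 4 L (Fintype.card n) ^ 2 * ε ^ 2))
                        * (4 * CP * Fintype.card n)))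
                      * (2 * curl1C 4 L * ε * (128 * (C1cov 4 * (L : ℝ) ^ 2 * (4 * (4 * (L : ℝ) + 1) ^ 4)) * (L : ℝ) ^ 2)) * (2 * liftMassC 4 L + 4 * CP * liftCurlC 4 L)
                    + (1 - (2 * curl1C 4 L * ε * (128 * (C1cov 4 * (L : ℝ) ^ 2 * (4 * (4 * (L : ℝ) + 1) ^ 4)) * (L : ℝ) ^ 2)) * (2 * (4 * CP * Fintype.card n)))
                      * (2 * ((1 + θ) * (14 * (Fintype.card (T4AveragingDeficitWall.Plane 4) : ℝ) * ε) + (1 + θ⁻¹) * (36 * eC 4 L (Fintype.card n) ^ 2 * ε ^ 2))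
                        * (2 * liftMassC 4 L + 4 * CP * liftCurlC 4 L)))
                * dirSq (chartDir (ContinuousLinearMap.id ℝ (Matrix n n ℂ)) N (v : TDir 4 n N)) (periodBox N) := by
  obtain ⟨ε₁, hε₁, T⟩ := effectiveForm_lower_bound_of_localLetter_uniform (n := n) hL
  obtain ⟨ε₂, hε₂, S⟩ := stripped_multiplier_letter_allData (n := n) hL
  refine ⟨min ε₁ ε₂, lt_min hε₁ hε₂,
    fun ε hε hεle hεD2 hεT2 hεM hε1 hcrux hθl2 hEl hα3 hα4 hroom hD hS N _ hN => ?_⟩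
  have hC0 : 0 ≤ C0 4 := by unfold C0; positivity
  have hα3' : C0 4 * (3 * ε) ≤ 1 / 3 := by nlinarith
  have hα4' : 4 * (3 * ε) ≤ c2' 4 L := by linarith
  obtain ⟨δ₁, hδ₁, T1⟩ := T ε hε (hεle.trans (min_le_left _ _)) hεD2 hεT2 hεM hε1 hcrux hθl2 hEl hα3' hα4' hroom N hN
  obtain ⟨δ₂, hδ₂, S1⟩ := S ε hε (hεle.trans (min_le_right _ _)) hα3 hα4 hroom hD hS N hN
  refine ⟨min δ₁ δ₂, lt_min hδ₁ hδ₂, fun j V₀ hV₀ Us hUs CP hCP hSP habs θ hθ hCΛa v => ?_⟩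
  obtain ⟨hV₀u, hV₀P, hV₀δ⟩ := hV₀
  have hV₀1 : V₀ ∈ {V : Site 4 → Fin 4 → (Matrix n n ℂ)ˣ | IsUnitaryCfg V ∧ IsPeriodicCfg V (N : ℤ) ∧ SmallField V δ₁} :=
    ⟨hV₀u, hV₀P, MinimalActionRate.SmallField.mono hV₀δ (min_le_left _ _)⟩
  have hV₀2 : V₀ ∈ {V : Site 4 → Fin 4 → (Matrix n n ℂ)ˣ | IsUnitaryCfg V ∧ IsPeriodicCfg V (N : ℤ) ∧ SmallField V δ₂} :=
    ⟨hV₀u, hV₀P, MinimalActionRate.SmallField.mono hV₀δ (min_le_right _ _)⟩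
  have hCΛ0 : 0 ≤ 2 * curl1C 4 L * ε * (128 * (C1cov 4 * (L : ℝ) ^ 2 * (4 * (4 * (L : ℝ) + 1) ^ 4)) * (L : ℝ) ^ 2) := by
    have := curl1C_nonneg 4 L; have := C1cov_pos 4; positivity
  have hw : ((stepWt 4 L)⁻¹) ^ (j + 1) = 1 := by rw [stepWt_four]; simp
  refine T1 j V₀ hV₀1 Us hUs CP hCP hSP habs θ hθ _ hCΛ0 hCΛa (fun X _ => ?_) v
  rw [hw, one_mul]
  exact S1 j V₀ hV₀2 Us hUs X

/-- **(G′) AT d = 4, ALL HYPOTHESES NUMERIC, LEVEL-UNIFORM DATUM RADIUS** (`∀ N ∃ δV ∀ j`; see the module docstring): `C_P := CPLine 4 L (card n) ε_c τ`, `C_Λ(ε) := 2·curl1C·ε·(128·C₁L²·4(4L+1)⁴·L²)`; for every small `ε`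
(the displayed lines), every `N ≥ 1` and every `j`, there is `δV > 0` such that for every `δV`-small datum `V₀`, every minimiser `U♯`, every `θ > 0` and every coarse direction `v`,
`(1 − C_Λa)·w·Σ_P nhs(curl_{V₀} ṽ) ≤ A·D²(minAct∘chart_{V₀})(0)[v,v] + w·(2A·C_Λ·ρ + (1 − C_Λa)·2K·ρ)·dirSq ṽ`. [folklore] -/
theorem effectiveForm_lower_bound_class_uniform [Nonempty n] {L : ℕ} [NeZero L] (hL : 2 ≤ L) :
    ∃ ε₀ : ℝ, 0 < ε₀ ∧ ∀ ε : ℝ, 0 < ε → ε ≤ ε₀ →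
      4 * (2 * ε) * radD 4 L * (((L : ℝ) ^ 2)⁻¹) ^ 2 ≤ 1 → twoLevelSmall 4 L * (2 * (2 * ε) * ((L : ℝ) ^ 2)⁻¹) ≤ 1 →
      8 * (L : ℝ) * mC 4 L (Fintype.card n) * ε * ((L : ℝ) ^ 2)⁻¹ ≤ 1 → ε ≤ 1 → cruxC 4 L * ε < 1 → thetaLoc 4 L * ε ≤ 1 / 2 → 43584 * ε ≤ 1 / 2 →
      C0 4 * (2 * (3 * ε)) ≤ 1 / 3 → 4 * (2 * (3 * ε)) ≤ c2' 4 L →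
      Real.exp (4 * (800 * (((4 : ℕ) : ℝ) + 1) ^ 2 * (((4 : ℕ) : ℝ) + 4)) * (3 * ε)) ≤ 3 / 2 →
      4 * ε * radD 4 L * (((L : ℝ) ^ 2)⁻¹) ^ 2 ≤ 1 →
      (16 * ((4 : ℝ) + 1) * ((4 : ℝ) + 4) * (L : ℝ) ^ 2 * Csup 4 L * (4 * (2 * (nbRad 4 L : ℝ) + 1) ^ 4)) * (8 / 3 * ε * ((L : ℝ) ^ 2)⁻¹) ≤ ((L : ℝ) / (L : ℝ) ^ 4) / 2 →
      -- the K-road lines of row NE3's class slice Poincaré inequality, in the auxiliary parameters `τ, ε_c`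
      ∀ τ εc : ℝ, ε ≤ τ → 0 < εc →
      16 * (14464 * (((4 : ℕ) : ℝ) + 1) ^ 2 * (((4 : ℕ) : ℝ) + 4) ^ 2) * ε ≤ 3 → 2 * twoLevelSmall 4 L * ε ≤ (L : ℝ) ^ 2 →
      ShLine 4 L (Fintype.card n) εc τ ≤ 1 / 2 → SmallYLine 4 L (Fintype.card n) εc τ ≤ 1 / 2 →
      68 / 3 * ((((4 : ℕ) : ℝ) + 1) * (((4 : ℕ) : ℝ) + 4)) * C2sq 4 L * τ ≤ rho 4 L / 2 →
      8 * ((4 : ℕ) : ℝ) * ((((4 : ℕ) : ℝ) - 1) * τ) ^ 2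
        + 2 * ((Fintype.card n : ℝ) * ((4 * ((4 : ℕ) : ℝ) ^ 2 + 272 * ((4 : ℕ) : ℝ) * ((((4 : ℕ) : ℝ) + 1) * (((4 : ℕ) : ℝ) + 4))) * τ) ^ 2) ≤ 1 / 2 →
      -- the two `(ε, C_P)`-lines
      28 * (Fintype.card (T4AveragingDeficitWall.Plane 4) : ℝ) * ε * (4 * CPLine 4 L (Fintype.card n) εc τ * Fintype.card n) ≤ 1 →
      (2 * curl1C 4 L * ε * (128 * (C1cov 4 * (L : ℝ) ^ 2 * (4 * (4 * (L : ℝ) + 1) ^ 4)) * (L : ℝ) ^ 2)) * (2 * (4 * CPLine 4 L (Fintype.card n) εc τ * Fintype.card n)) ≤ 1 →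
      ∀ (N : ℕ) [NeZero N], 1 ≤ N →
      ∃ δV : ℝ, 0 < δV ∧ ∀ j : ℕ,
        ∀ V₀ ∈ {V : Site 4 → Fin 4 → (Matrix n n ℂ)ˣ | IsUnitaryCfg V ∧ IsPeriodicCfg V (N : ℤ) ∧ SmallField V δV},
        ∀ Us : Site 4 → Fin 4 → (Matrix n n ℂ)ˣ, IsMinimiser 4 (sfClass 4 L N ε) L N (j + 1) V₀ Us → ∀ θ : ℝ, 0 < θ →
        ∀ v : ↥(skewSub 4 n N),
          (1 - (2 * curl1C 4 L * ε * (128 * (C1cov 4 * (L : ℝ) ^ 2 * (4 * (4 * (L : ℝ) + 1) ^ 4)) * (L : ℝ) ^ 2)) * (2 * (4 * CPLine 4 L (Fintype.card n) εc τ * Fintype.card n)))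
              * (((stepWt 4 L)⁻¹) ^ (j + 1) * ∑ P ∈ perWin 4 N, nhsNormSq (curl V₀ (chartDir (ContinuousLinearMap.id ℝ (Matrix n n ℂ)) N (v : TDir 4 n N)) P))
            ≤ ((1 + θ) + 2 * ((1 + θ) * (14 * (Fintype.card (T4AveragingDeficitWall.Plane 4) : ℝ) * ε) + (1 + θ⁻¹) * (36 * eC 4 L (Fintype.card n) ^ 2 * ε ^ 2))
                    * (4 * CPLine 4 L (Fintype.card n) εc τ * Fintype.card n))
                * fderiv ℝ (fderiv ℝ (fun y : ↥(skewSub 4 n N) => minAct 4 (sfClass 4 L N ε) L N (j + 1) (chart (ContinuousLinearMap.id ℝ (Matrix n n ℂ)) N V₀ (y : TDir 4 n N)))) 0 v v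
              + ((stepWt 4 L)⁻¹) ^ (j + 1)
                * (2 * (((1 + θ) + 2 * ((1 + θ) * (14 * (Fintype.card (T4AveragingDeficitWall.Plane 4) : ℝ) * ε) + (1 + θ⁻¹) * (36 * eC 4 L (Fintype.card n) ^ 2 * ε ^ 2))
                        * (4 * CPLine 4 L (Fintype.card n) εc τ * Fintype.card n)))
                      * (2 * curl1C 4 L * ε * (128 * (C1cov 4 * (L : ℝ) ^ 2 * (4 * (4 * (L : ℝ) + 1) ^ 4)) * (L : ℝ) ^ 2)) * (2 * liftMassC 4 L + 4 * CPLine 4 L (Fintype.card n) εc τ * liftCurlC 4 L)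
                    + (1 - (2 * curl1C 4 L * ε * (128 * (C1cov 4 * (L : ℝ) ^ 2 * (4 * (4 * (L : ℝ) + 1) ^ 4)) * (L : ℝ) ^ 2)) * (2 * (4 * CPLine 4 L (Fintype.card n) εc τ * Fintype.card n)))
                      * (2 * ((1 + θ) * (14 * (Fintype.card (T4AveragingDeficitWall.Plane 4) : ℝ) * ε) + (1 + θ⁻¹) * (36 * eC 4 L (Fintype.card n) ^ 2 * ε ^ 2))
                        * (2 * liftMassC 4 L + 4 * CPLine 4 L (Fintype.card n) εc τ * liftCurlC 4 L)))
                * dirSq (chartDir (ContinuousLinearMap.id ℝ (Matrix n n ℂ)) N (v : TDir 4 n N)) (periodBox N) := by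
  obtain ⟨ε₁, hε₁, T⟩ := effectiveForm_lower_bound_uniform (n := n) hL
  refine ⟨ε₁, hε₁, fun ε hε hεle hεD2 hεT2 hεM hε1 hcrux hθl2 hEl hα3 hα4 hroom hD hS τ εc hετ hεc hc1 hc2 h1 h2 h3 h4 habs hCΛa N _ hN => ?_⟩
  obtain ⟨δV, hδV, T1⟩ := T ε hε hεle hεD2 hεT2 hεM hε1 hcrux hθl2 hEl hα3 hα4 hroom hD hS N hN
  refine ⟨δV, hδV, fun j V₀ hV₀ Us hUs θ hθ v => ?_⟩
  have hCP : 0 ≤ CPLine 4 L (Fintype.card n) εc τ := CPLine_nonneg (by norm_num) (Nat.cast_nonneg _) hεc.le (hε.le.trans hετ)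
  have hSP : SlicePoincare L (j + 1) Us (frameFreeBlockLandauW (d := 4) (n := n) L N (j + 1) Us) (CPLine 4 L (Fintype.card n) εc τ) (periodBox (N * L ^ (j + 1))) :=
    classSlicePoincare_of_lines' (d := 4) (by norm_num) hL hN hε hετ hεc hc1 hc2 h1 h2 h3 h4 j Us hUs.mem.1
  exact T1 j V₀ hV₀ Us hUs _ hCP hSP habs θ hθ hCΛa v

end

end Summit.QuantumFields.BalabanUV.T4Continuum.NE7EffectiveFormLowerBoundUniform
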